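import Mathlib

/-!
# Crux `NearExtremalTransiencePerFlow` (stmt-NavierStokesRegularity-26567), LINE g12-α `transience_exit`:
# STUB G `stub_forwardGapCovering` — the forward-gap covering lemma (pure real analysis)

Theorems file (lands `--supports stmt-NavierStokesRegularity-26567`) proving the by-text stub
`stub_forwardGapCovering : ForwardGapCovering` of the files-only skeleton
`Cruxes/NearExtremalTransiencePerFlow/Lines/transience_exit.lean` (ns-idea-5 g12, commit 0e87ffb200ce), with the
statement of `ForwardGapCovering` unfolded VERBATIM (so `stub_forwardGapCovering := forwardGapCovering_holds` closes it).

Statement.  For `0 < a₁ ≤ a₂ < 1/2` there are `c > 0`, `C₀ ≥ 0` such that: whenever `S ⊆ [t₁,t]`, `t < T`, `S ∩ F = ∅`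
and every `t' ∈ S` kills a forward window `[t' + a(T−t'), t' + 2a(T−t')] ⊆ F` with `a ∈ [a₁,a₂]`, then
`c·∫_{t₁}^{t} 1_S/(T−τ) ≤ ∫_{t₁}^{t} 1_F/(T−τ) + C₀`.

Proof (Tonelli with crude bounds — no covering argument and no logarithms are needed).  Write `ρ(τ) = 1/(T−τ)`.
(1) Each `t' ∈ S` has its killed window inside `F ∩ W(t')`, `W(t') = [t' + a₁(T−t'), t' + 2a₂(T−t')]`, and the window
carries `∫ ρ ≥ a ≥ a₁` (length `a(T−t')`, weight `≥ 1/(T−t')`).  (2) Integrate over `t' ∈ S` against `ρ(t')dt'` and swap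
the integrals.  (3) For fixed `t''` the admissible `t'` (those with `t'' ∈ W(t')`) form the interval
`[T − (T−t'')/(1−2a₂), T − (T−t'')/(1−a₁)]`, of length `≤ (T−t'')/(1−2a₂)`, on which `ρ(t') ≤ (1−a₁)/(T−t'')`; so the
inner integral is `≤ B = (1−a₁)/(1−2a₂)`, and it vanishes unless `t₁ < t'' ≤ T − (1−2a₂)(T−t)`.  (4) The part of that
range beyond `t` costs `≤ 2a₂/(1−2a₂)`.  Hence `a₁·Λ(S) ≤ B·(Λ(F ∩ [t₁,t]) + 2a₂/(1−2a₂))`: `c = a₁/B`,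
`C₀ = 2a₂/(1−2a₂)`.
HONEST FRAMING: a lemma about sets of reals and one weight; nothing about Navier–Stokes is proved here; no summit is
proved by a line. [folklore]
-/

noncomputable section

open Set MeasureTheory
open scoped ENNReal

namespace Summit.NavierStokesRegularity.NavierStokesRegularity.Theorems.NearExtremalTransiencePerFlow.TransienceExit
-- the summit's namespace `Summit.NavierStokesRegularity.NavierStokesRegularity` repeats the problem name by convention (D-0017)
set_option linter.dupNamespace false

/-! ### The weight `ρ(τ) = 1/(T−τ)` and the window relation -/

/-- The log-time weight `τ ↦ 1/(T−τ)` (as an `ℝ≥0∞`-valued function) is measurable. [folklore] -/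
theorem measurable_weight (T : ℝ) : Measurable fun τ : ℝ => ENNReal.ofReal (1 / (T - τ)) :=
  ENNReal.measurable_ofReal.comp (measurable_const.div (measurable_const.sub measurable_id))

/-- The window relation `{(t',t'') : t' + a₁(T−t') ≤ t'' ≤ t' + 2a₂(T−t')}` is a closed, hence measurable, subset
of `ℝ × ℝ`. [folklore] -/
theorem measurableSet_windowRel (T a₁ a₂ : ℝ) :
    MeasurableSet {p : ℝ × ℝ | p.1 + a₁ * (T - p.1) ≤ p.2 ∧ p.2 ≤ p.1 + 2 * a₂ * (T - p.1)} := by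
  have h1 : IsClosed {p : ℝ × ℝ | p.1 + a₁ * (T - p.1) ≤ p.2} := isClosed_le (by fun_prop) (by fun_prop)
  have h2 : IsClosed {p : ℝ × ℝ | p.2 ≤ p.1 + 2 * a₂ * (T - p.1)} := isClosed_le (by fun_prop) (by fun_prop)
  rw [setOf_and]
  exact (h1.inter h2).measurableSet

/-! ### (1) The killed window of one point carries weight `≥ a₁` -/

/-- Step (1): if `t' < T` kills the window `[t' + a(T−t'), t' + 2a(T−t')] ⊆ F` with `a₁ ≤ a ≤ a₂ < 1/2`, then
`a₁ ≤ ∫_{F ∩ W(t')} ρ`. [folklore] -/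
theorem window_weight_ge {T t' a a₁ a₂ : ℝ} {F : Set ℝ} (ρ : ℝ → ℝ≥0∞)
    (hρ : ∀ τ, ρ τ = ENNReal.ofReal (1 / (T - τ))) (P : Set (ℝ × ℝ))
    (hP : ∀ p : ℝ × ℝ, p ∈ P ↔ p.1 + a₁ * (T - p.1) ≤ p.2 ∧ p.2 ≤ p.1 + 2 * a₂ * (T - p.1))
    (ht' : t' < T) (ha₁ : 0 < a₁) (ha₁a : a₁ ≤ a) (haa₂ : a ≤ a₂) (ha₂ : a₂ < 1 / 2)
    (hwin : ∀ t'' : ℝ, t' + a * (T - t') ≤ t'' → t'' ≤ t' + 2 * a * (T - t') → t'' ∈ F) :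
    ENNReal.ofReal a₁ ≤ ∫⁻ t'' in F, P.indicator (fun _ => (1 : ℝ≥0∞)) (t', t'') * ρ t'' := by
  have hTt' : 0 < T - t' := sub_pos.2 ht'
  have ha : 0 < a := lt_of_lt_of_le ha₁ ha₁a
  have hIF : Icc (t' + a * (T - t')) (t' + 2 * a * (T - t')) ⊆ F := fun t'' h => hwin t'' h.1 h.2
  calc ENNReal.ofReal a₁ ≤ ENNReal.ofReal a := ENNReal.ofReal_le_ofReal ha₁a
    _ = ENNReal.ofReal (1 / (T - t')) * volume (Icc (t' + a * (T - t')) (t' + 2 * a * (T - t'))) := by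
        rw [Real.volume_Icc, ← ENNReal.ofReal_mul (div_nonneg zero_le_one hTt'.le)]
        congr 1
        field_simp
        ring
    _ = ∫⁻ _ in Icc (t' + a * (T - t')) (t' + 2 * a * (T - t')), ENNReal.ofReal (1 / (T - t')) :=
        (setLIntegral_const _ _).symm
    _ ≤ ∫⁻ t'' in Icc (t' + a * (T - t')) (t' + 2 * a * (T - t')),
          P.indicator (fun _ => (1 : ℝ≥0∞)) (t', t'') * ρ t'' := by
        refine setLIntegral_mono' measurableSet_Icc fun t'' ht'' => ?_
        have h₁ : a₁ * (T - t') ≤ a * (T - t') := mul_le_mul_of_nonneg_right ha₁a hTt'.le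
        have h₂ : a * (T - t') ≤ a₂ * (T - t') := mul_le_mul_of_nonneg_right haa₂ hTt'.le
        have hmem : (t', t'') ∈ P := by
          rw [hP]
          constructor
          · linarith [ht''.1]
          · linarith [ht''.2]
        rw [indicator_of_mem hmem, one_mul, hρ]
        refine ENNReal.ofReal_le_ofReal ?_
        have h12a : 0 < 1 - 2 * a := by linarith
        have h₃ : 0 < (1 - 2 * a) * (T - t') := mul_pos h12a hTt'
        have h₄ : (1 - 2 * a) * (T - t') = (T - t') - 2 * a * (T - t') := by ring
        have hpos : 0 < T - t'' := by linarith [ht''.2]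
        have hle : T - t'' ≤ T - t' := by
          have : 0 ≤ a * (T - t') := mul_nonneg ha.le hTt'.le
          linarith [ht''.1]
        exact one_div_le_one_div_of_le hpos hle
    _ ≤ ∫⁻ t'' in F, P.indicator (fun _ => (1 : ℝ≥0∞)) (t', t'') * ρ t'' := lintegral_mono_set hIF

/-! ### (3) The inner integral after the swap is bounded and supported in `(t₁, T − (1−2a₂)(T−t)]` -/

/-- Step (3): for fixed `t''`, the `ρ`-weight of the points `t' ∈ S ⊆ [t₁,t]` whose window `W(t')` contains `t''` is at
most `(1−a₁)/(1−2a₂)`, and it vanishes unless `t₁ < t'' ≤ T − (1−2a₂)(T−t)`. [folklore] -/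
theorem inner_weight_le {T t₁ t t'' a₁ a₂ : ℝ} {S : Set ℝ} (ρ : ℝ → ℝ≥0∞)
    (hρ : ∀ τ, ρ τ = ENNReal.ofReal (1 / (T - τ))) (P : Set (ℝ × ℝ))
    (hP : ∀ p : ℝ × ℝ, p ∈ P ↔ p.1 + a₁ * (T - p.1) ≤ p.2 ∧ p.2 ≤ p.1 + 2 * a₂ * (T - p.1))
    (hS : MeasurableSet S) (hSsub : S ⊆ Icc t₁ t) (htT : t < T) (ha₁ : 0 < a₁) (h12 : a₁ ≤ a₂)
    (ha₂ : a₂ < 1 / 2) :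
    ∫⁻ t' in S, P.indicator (fun _ => (1 : ℝ≥0∞)) (t', t'') * ρ t' ≤
      (Ioc t₁ (T - (1 - 2 * a₂) * (T - t))).indicator
        (fun _ => ENNReal.ofReal ((1 - a₁) / (1 - 2 * a₂))) t'' := by
  have h1a₁ : 0 < 1 - a₁ := by linarith
  have h2a₂ : 0 < 1 - 2 * a₂ := by linarith
  have hTt : 0 < T - t := sub_pos.2 htT
  by_cases hmem : t'' ∈ Ioc t₁ (T - (1 - 2 * a₂) * (T - t))
  · rw [indicator_of_mem hmem]
    have hTt'' : 0 < T - t'' := by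
      have : 0 < (1 - 2 * a₂) * (T - t) := mul_pos h2a₂ hTt
      linarith [hmem.2]
    have hlen : 0 ≤ (T - t'') / (1 - a₁) := div_nonneg hTt''.le h1a₁.le
    calc ∫⁻ t' in S, P.indicator (fun _ => (1 : ℝ≥0∞)) (t', t'') * ρ t'
        ≤ ∫⁻ t' in S, (Icc (T - (T - t'') / (1 - 2 * a₂)) (T - (T - t'') / (1 - a₁))).indicator
            (fun _ => ENNReal.ofReal ((1 - a₁) / (T - t''))) t' := by
          refine setLIntegral_mono' hS fun t' ht' => ?_
          by_cases hK : (t', t'') ∈ P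
          · obtain ⟨hK1, hK2⟩ := (hP _).1 hK
            have hlo : T - t' ≤ (T - t'') / (1 - 2 * a₂) := by
              rw [le_div_iff₀ h2a₂]
              nlinarith
            have hhi : (T - t'') / (1 - a₁) ≤ T - t' := by
              rw [div_le_iff₀ h1a₁]
              nlinarith
            have hV : t' ∈ Icc (T - (T - t'') / (1 - 2 * a₂)) (T - (T - t'') / (1 - a₁)) :=
              ⟨by linarith, by linarith⟩
            rw [indicator_of_mem hK, one_mul, indicator_of_mem hV, hρ]
            refine ENNReal.ofReal_le_ofReal ?_
            have hpos : 0 < (T - t'') / (1 - a₁) := div_pos hTt'' h1a₁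
            calc 1 / (T - t') ≤ 1 / ((T - t'') / (1 - a₁)) := one_div_le_one_div_of_le hpos hhi
              _ = (1 - a₁) / (T - t'') := one_div_div _ _
          · rw [indicator_of_notMem hK, zero_mul]
            exact bot_le
      _ ≤ ∫⁻ t', (Icc (T - (T - t'') / (1 - 2 * a₂)) (T - (T - t'') / (1 - a₁))).indicator
            (fun _ => ENNReal.ofReal ((1 - a₁) / (T - t''))) t' := setLIntegral_le_lintegral _ _
      _ = ENNReal.ofReal ((1 - a₁) / (T - t'')) *
            volume (Icc (T - (T - t'') / (1 - 2 * a₂)) (T - (T - t'') / (1 - a₁))) :=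
          lintegral_indicator_const measurableSet_Icc _
      _ ≤ ENNReal.ofReal ((1 - a₁) / (T - t'')) * ENNReal.ofReal ((T - t'') / (1 - 2 * a₂)) := by
          rw [Real.volume_Icc]
          gcongr
          linarith
      _ = ENNReal.ofReal ((1 - a₁) / (1 - 2 * a₂)) := by
          rw [← ENNReal.ofReal_mul (div_pos h1a₁ hTt'').le]
          congr 1
          field_simp
  · rw [indicator_of_notMem hmem]
    refine le_of_eq (setLIntegral_eq_zero hS fun t' ht' => ?_)
    have ht'₁ : t₁ ≤ t' := (hSsub ht').1
    have ht't : t' ≤ t := (hSsub ht').2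
    have hTt' : 0 < T - t' := by linarith
    have hK : (t', t'') ∉ P := by
      intro hK
      obtain ⟨hK1, hK2⟩ := (hP _).1 hK
      apply hmem
      constructor
      · have : 0 < a₁ * (T - t') := mul_pos ha₁ hTt'
        linarith
      · have h₁ : (1 - 2 * a₂) * (T - t) ≤ (1 - 2 * a₂) * (T - t') :=
          mul_le_mul_of_nonneg_left (by linarith) h2a₂.le
        have h₂ : t' + 2 * a₂ * (T - t') = T - (1 - 2 * a₂) * (T - t') := by ring
        linarith
    simp [indicator_of_notMem hK]

/-! ### (4) The tail beyond `t` -/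

/-- Step (4): `∫_{(t, T − (1−2a₂)(T−t)]} ρ ≤ 2a₂/(1−2a₂)`. [folklore] -/
theorem tail_weight_le {T t a₂ : ℝ} (ρ : ℝ → ℝ≥0∞) (hρ : ∀ τ, ρ τ = ENNReal.ofReal (1 / (T - τ)))
    (htT : t < T) (ha₂ : a₂ < 1 / 2) :
    ∫⁻ τ in Ioc t (T - (1 - 2 * a₂) * (T - t)), ρ τ ≤ ENNReal.ofReal (2 * a₂ / (1 - 2 * a₂)) := by
  have h2a₂ : 0 < 1 - 2 * a₂ := by linarith
  have hTt : 0 < T - t := sub_pos.2 htT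
  have hpos : 0 < (1 - 2 * a₂) * (T - t) := mul_pos h2a₂ hTt
  calc ∫⁻ τ in Ioc t (T - (1 - 2 * a₂) * (T - t)), ρ τ
      ≤ ∫⁻ _ in Ioc t (T - (1 - 2 * a₂) * (T - t)), ENNReal.ofReal (1 / ((1 - 2 * a₂) * (T - t))) := by
        refine setLIntegral_mono' measurableSet_Ioc fun τ hτ => ?_
        rw [hρ]
        exact ENNReal.ofReal_le_ofReal (one_div_le_one_div_of_le hpos (by linarith [hτ.2]))
    _ = ENNReal.ofReal (1 / ((1 - 2 * a₂) * (T - t))) * volume (Ioc t (T - (1 - 2 * a₂) * (T - t))) :=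
        setLIntegral_const _ _
    _ = ENNReal.ofReal (2 * a₂ / (1 - 2 * a₂)) := by
        rw [Real.volume_Ioc, ← ENNReal.ofReal_mul (one_div_pos.2 hpos).le]
        congr 1
        field_simp
        ring

/-! ### The weighted interval integrals as Lebesgue integrals -/

/-- `∫_{t₁}^{t} 1_A(τ)/(T−τ) dτ = (∫⁻_{A ∩ (t₁,t]} ρ).toReal` for measurable `A` and `t₁ ≤ t < T`. [folklore] -/
theorem intervalIntegral_indicator_div_eq_toReal {T t₁ t : ℝ} {A : Set ℝ} (ρ : ℝ → ℝ≥0∞)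
    (hρ : ∀ τ, ρ τ = ENNReal.ofReal (1 / (T - τ))) (hA : MeasurableSet A) (ht₁t : t₁ ≤ t) (htT : t < T) :
    ∫ τ in t₁..t, A.indicator (fun _ => (1 : ℝ)) τ / (T - τ) = (∫⁻ τ in A ∩ Ioc t₁ t, ρ τ).toReal := by
  rw [intervalIntegral.integral_of_le ht₁t]
  have hnn : 0 ≤ᵐ[volume.restrict (Ioc t₁ t)] fun τ => A.indicator (fun _ => (1 : ℝ)) τ / (T - τ) := by
    refine ae_restrict_of_forall_mem measurableSet_Ioc fun τ hτ => ?_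
    have : 0 < T - τ := by linarith [hτ.2]
    exact div_nonneg (Set.indicator_nonneg (fun _ _ => zero_le_one) _) this.le
  have hmeas : Measurable fun τ => A.indicator (fun _ => (1 : ℝ)) τ / (T - τ) :=
    (measurable_const.indicator hA).div (measurable_const.sub measurable_id)
  rw [integral_eq_lintegral_of_nonneg_ae hnn hmeas.aestronglyMeasurable]
  have hpt : (fun τ => ENNReal.ofReal (A.indicator (fun _ => (1 : ℝ)) τ / (T - τ))) = A.indicator ρ := by
    funext τ
    by_cases h : τ ∈ A
    · rw [indicator_of_mem h, indicator_of_mem h, hρ]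
    · rw [indicator_of_notMem h, indicator_of_notMem h, zero_div, ENNReal.ofReal_zero]
  rw [hpt, setLIntegral_indicator hA]

/-! ### The stub -/

/-- **G `stub_forwardGapCovering`** of LINE g12-α `transience_exit` (crux stmt-NavierStokesRegularity-26567), the
statement of `ForwardGapCovering` VERBATIM: the one-sided forward-gap covering inequality in log-time,
`c·Λ(S) ≤ Λ(F ∩ [t₁,t]) + C₀` with `c = a₁(1−2a₂)/(1−a₁)` and `C₀ = 2a₂/(1−2a₂)`. [folklore] -/
theorem forwardGapCovering_holds :
    ∀ a₁ a₂ : ℝ, 0 < a₁ → a₁ ≤ a₂ → a₂ < 1 / 2 → ∃ c C₀ : ℝ, 0 < c ∧ 0 ≤ C₀ ∧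
    ∀ (T t₁ t : ℝ) (S F : Set ℝ), t₁ ≤ t → t < T → MeasurableSet S → MeasurableSet F → S ⊆ Set.Icc t₁ t →
      Disjoint S F →
      (∀ t' ∈ S, ∃ a : ℝ, a₁ ≤ a ∧ a ≤ a₂ ∧
        ∀ t'' : ℝ, t' + a * (T - t') ≤ t'' → t'' ≤ t' + 2 * a * (T - t') → t'' ∈ F) →
      c * (∫ τ in t₁..t, Set.indicator S (fun _ => (1 : ℝ)) τ / (T - τ)) ≤
        (∫ τ in t₁..t, Set.indicator F (fun _ => (1 : ℝ)) τ / (T - τ)) + C₀ := by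
  intro a₁ a₂ ha₁ h12 ha₂
  have h1a₁ : 0 < 1 - a₁ := by linarith
  have h2a₂ : 0 < 1 - 2 * a₂ := by linarith
  have hB : 0 < (1 - a₁) / (1 - 2 * a₂) := div_pos h1a₁ h2a₂
  have hC₀ : 0 ≤ 2 * a₂ / (1 - 2 * a₂) := div_nonneg (by linarith) h2a₂.le
  refine ⟨a₁ * (1 - 2 * a₂) / (1 - a₁), 2 * a₂ / (1 - 2 * a₂), div_pos (mul_pos ha₁ h2a₂) h1a₁, hC₀, ?_⟩
  intro T t₁ t S F ht₁t htT hSm hFm hSsub _hSF hkill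
  -- the weight, the window relation, the trimmed set `S' = S ∩ (t₁,t]`, the end of the support `t⋆`
  obtain ⟨ρ, hρ⟩ : ∃ ρ : ℝ → ℝ≥0∞, ∀ τ, ρ τ = ENNReal.ofReal (1 / (T - τ)) := ⟨fun τ => _, fun τ => rfl⟩
  have hρm : Measurable ρ := by
    rw [show ρ = fun τ => ENNReal.ofReal (1 / (T - τ)) from funext hρ]
    exact measurable_weight T
  have hρtop : ∀ τ, ρ τ ≠ ∞ := fun τ => by rw [hρ]; exact ENNReal.ofReal_ne_top
  obtain ⟨P, hP⟩ : ∃ P : Set (ℝ × ℝ), ∀ p : ℝ × ℝ, p ∈ P ↔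
      p.1 + a₁ * (T - p.1) ≤ p.2 ∧ p.2 ≤ p.1 + 2 * a₂ * (T - p.1) :=
    ⟨{p | p.1 + a₁ * (T - p.1) ≤ p.2 ∧ p.2 ≤ p.1 + 2 * a₂ * (T - p.1)}, fun p => Iff.rfl⟩
  have hPm : MeasurableSet P := by
    rw [show P = {p : ℝ × ℝ | p.1 + a₁ * (T - p.1) ≤ p.2 ∧ p.2 ≤ p.1 + 2 * a₂ * (T - p.1)} from
      Set.ext fun p => hP p]
    exact measurableSet_windowRel T a₁ a₂
  have hS'm : MeasurableSet (S ∩ Ioc t₁ t) := hSm.inter measurableSet_Ioc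
  have hS'sub : S ∩ Ioc t₁ t ⊆ Icc t₁ t := fun x hx => hSsub hx.1
  -- the two real integrals as Lebesgue integrals
  rw [intervalIntegral_indicator_div_eq_toReal ρ hρ hSm ht₁t htT,
    intervalIntegral_indicator_div_eq_toReal ρ hρ hFm ht₁t htT]
  -- the kernel of the double integral
  have hf : Measurable (Function.uncurry fun t' t'' : ℝ =>
      P.indicator (fun _ => (1 : ℝ≥0∞)) (t', t'') * ρ t' * ρ t'') := by
    have e : (Function.uncurry fun t' t'' : ℝ => P.indicator (fun _ => (1 : ℝ≥0∞)) (t', t'') * ρ t' * ρ t'') =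
        fun p => P.indicator (fun _ => (1 : ℝ≥0∞)) p * ρ p.1 * ρ p.2 := by
      funext p
      rfl
    rw [e]
    exact ((measurable_const.indicator hPm).mul (hρm.comp measurable_fst)).mul (hρm.comp measurable_snd)
  -- (1) pointwise on `S'`
  have hstep1 : ∀ t' ∈ S ∩ Ioc t₁ t, ENNReal.ofReal a₁ * ρ t' ≤
      ∫⁻ t'' in F, P.indicator (fun _ => (1 : ℝ≥0∞)) (t', t'') * ρ t' * ρ t'' := by
    intro t' ht'
    obtain ⟨a, ha₁a, haa₂, hw⟩ := hkill t' ht'.1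
    have ht'T : t' < T := lt_of_le_of_lt (hSsub ht'.1).2 htT
    have hwl := window_weight_ge ρ hρ P hP ht'T ha₁ ha₁a haa₂ ha₂ hw
    calc ENNReal.ofReal a₁ * ρ t'
        ≤ (∫⁻ t'' in F, P.indicator (fun _ => (1 : ℝ≥0∞)) (t', t'') * ρ t'') * ρ t' :=
          mul_le_mul_of_nonneg_right hwl bot_le
      _ = ∫⁻ t'' in F, P.indicator (fun _ => (1 : ℝ≥0∞)) (t', t'') * ρ t'' * ρ t' :=
          (lintegral_mul_const' _ _ (hρtop t')).symm
      _ = ∫⁻ t'' in F, P.indicator (fun _ => (1 : ℝ≥0∞)) (t', t'') * ρ t' * ρ t'' := by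
          congr 1
          funext t''
          ring
  -- (3) pointwise in `t''` after the swap
  have hstep3 : ∀ t'' : ℝ, ∫⁻ t' in S ∩ Ioc t₁ t, P.indicator (fun _ => (1 : ℝ≥0∞)) (t', t'') * ρ t' * ρ t'' ≤
      (Ioc t₁ (T - (1 - 2 * a₂) * (T - t))).indicator
        (fun _ => ENNReal.ofReal ((1 - a₁) / (1 - 2 * a₂))) t'' * ρ t'' := by
    intro t''
    rw [lintegral_mul_const' _ _ (hρtop t'')]
    exact mul_le_mul_of_nonneg_right (inner_weight_le ρ hρ P hP hS'm hS'sub htT ha₁ h12 ha₂) bot_le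
  -- (4) the support splits into `F ∩ (t₁,t]` and the tail `(t, t⋆]`
  have hsplit : ∫⁻ t'' in Ioc t₁ (T - (1 - 2 * a₂) * (T - t)) ∩ F, ρ t'' ≤
      (∫⁻ t'' in F ∩ Ioc t₁ t, ρ t'') + ENNReal.ofReal (2 * a₂ / (1 - 2 * a₂)) := by
    calc ∫⁻ t'' in Ioc t₁ (T - (1 - 2 * a₂) * (T - t)) ∩ F, ρ t''
        ≤ ∫⁻ t'' in (F ∩ Ioc t₁ t) ∪ Ioc t (T - (1 - 2 * a₂) * (T - t)), ρ t'' := by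
          refine lintegral_mono_set fun x hx => ?_
          rcases le_or_gt x t with hxt | hxt
          · exact Or.inl ⟨hx.2, hx.1.1, hxt⟩
          · exact Or.inr ⟨hxt, hx.1.2⟩
      _ ≤ (∫⁻ t'' in F ∩ Ioc t₁ t, ρ t'') + ∫⁻ t'' in Ioc t (T - (1 - 2 * a₂) * (T - t)), ρ t'' :=
          lintegral_union_le _ _ _
      _ ≤ (∫⁻ t'' in F ∩ Ioc t₁ t, ρ t'') + ENNReal.ofReal (2 * a₂ / (1 - 2 * a₂)) := by
          gcongr
          exact tail_weight_le ρ hρ htT ha₂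
  -- the main inequality in `ℝ≥0∞`
  have hmain : ENNReal.ofReal a₁ * ∫⁻ t' in S ∩ Ioc t₁ t, ρ t' ≤
      ENNReal.ofReal ((1 - a₁) / (1 - 2 * a₂)) *
        ((∫⁻ t'' in F ∩ Ioc t₁ t, ρ t'') + ENNReal.ofReal (2 * a₂ / (1 - 2 * a₂))) := by
    calc ENNReal.ofReal a₁ * ∫⁻ t' in S ∩ Ioc t₁ t, ρ t'
        = ∫⁻ t' in S ∩ Ioc t₁ t, ENNReal.ofReal a₁ * ρ t' :=
          (lintegral_const_mul' _ _ ENNReal.ofReal_ne_top).symm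
      _ ≤ ∫⁻ t' in S ∩ Ioc t₁ t, ∫⁻ t'' in F, P.indicator (fun _ => (1 : ℝ≥0∞)) (t', t'') * ρ t' * ρ t'' :=
          setLIntegral_mono' hS'm hstep1
      _ = ∫⁻ t'' in F, ∫⁻ t' in S ∩ Ioc t₁ t, P.indicator (fun _ => (1 : ℝ≥0∞)) (t', t'') * ρ t' * ρ t'' :=
          lintegral_lintegral_swap hf.aemeasurable
      _ ≤ ∫⁻ t'' in F, (Ioc t₁ (T - (1 - 2 * a₂) * (T - t))).indicator
            (fun _ => ENNReal.ofReal ((1 - a₁) / (1 - 2 * a₂))) t'' * ρ t'' :=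
          lintegral_mono hstep3
      _ = ∫⁻ t'' in F, (Ioc t₁ (T - (1 - 2 * a₂) * (T - t))).indicator
            (fun τ => ENNReal.ofReal ((1 - a₁) / (1 - 2 * a₂)) * ρ τ) t'' := by
          congr 1
          funext t''
          by_cases h : t'' ∈ Ioc t₁ (T - (1 - 2 * a₂) * (T - t))
          · rw [indicator_of_mem h, indicator_of_mem h]
          · rw [indicator_of_notMem h, indicator_of_notMem h, zero_mul]
      _ = ENNReal.ofReal ((1 - a₁) / (1 - 2 * a₂)) *
            ∫⁻ t'' in Ioc t₁ (T - (1 - 2 * a₂) * (T - t)) ∩ F, ρ t'' := by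
          rw [setLIntegral_indicator measurableSet_Ioc, lintegral_const_mul' _ _ ENNReal.ofReal_ne_top]
      _ ≤ ENNReal.ofReal ((1 - a₁) / (1 - 2 * a₂)) *
            ((∫⁻ t'' in F ∩ Ioc t₁ t, ρ t'') + ENNReal.ofReal (2 * a₂ / (1 - 2 * a₂))) :=
          mul_le_mul_of_nonneg_left hsplit bot_le
  -- finiteness of the right-hand side
  have hfinF : (∫⁻ t'' in F ∩ Ioc t₁ t, ρ t'') ≠ ∞ := by
    have hTt : 0 < T - t := sub_pos.2 htT
    refine ne_top_of_le_ne_top (b := ENNReal.ofReal (1 / (T - t)) * volume (Ioc t₁ t))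
      (ENNReal.mul_ne_top ENNReal.ofReal_ne_top (by rw [Real.volume_Ioc]; exact ENNReal.ofReal_ne_top)) ?_
    calc ∫⁻ t'' in F ∩ Ioc t₁ t, ρ t'' ≤ ∫⁻ t'' in Ioc t₁ t, ρ t'' := lintegral_mono_set inter_subset_right
      _ ≤ ∫⁻ _ in Ioc t₁ t, ENNReal.ofReal (1 / (T - t)) := by
          refine setLIntegral_mono' measurableSet_Ioc fun τ hτ => ?_
          rw [hρ]
          exact ENNReal.ofReal_le_ofReal (one_div_le_one_div_of_le hTt (by linarith [hτ.2]))
      _ = ENNReal.ofReal (1 / (T - t)) * volume (Ioc t₁ t) := setLIntegral_const _ _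
  have hfinR : ENNReal.ofReal ((1 - a₁) / (1 - 2 * a₂)) *
      ((∫⁻ t'' in F ∩ Ioc t₁ t, ρ t'') + ENNReal.ofReal (2 * a₂ / (1 - 2 * a₂))) ≠ ∞ :=
    ENNReal.mul_ne_top ENNReal.ofReal_ne_top (ENNReal.add_ne_top.2 ⟨hfinF, ENNReal.ofReal_ne_top⟩)
  -- back to `ℝ`
  have hreal := ENNReal.toReal_mono hfinR hmain
  rw [ENNReal.toReal_mul, ENNReal.toReal_ofReal ha₁.le, ENNReal.toReal_mul, ENNReal.toReal_ofReal hB.le,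
    ENNReal.toReal_add hfinF ENNReal.ofReal_ne_top, ENNReal.toReal_ofReal hC₀] at hreal
  have e : a₁ * (1 - 2 * a₂) / (1 - a₁) = a₁ / ((1 - a₁) / (1 - 2 * a₂)) := by
    field_simp
  rw [e, div_mul_eq_mul_div, div_le_iff₀ hB]
  linarith [hreal]

end Summit.NavierStokesRegularity.NavierStokesRegularity.Theorems.NearExtremalTransiencePerFlow.TransienceExit

end
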